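import Summits.ABC.IUTFork.Cor312SlotLicenceTame
import Summits.ABC.IUTFork.Cor312LicenceTameExactRealising
import HarnessLib

/-!
# [IUTchIII] Cor. 3.12 at the sharp real settings — the SLOT licence (reading (P)) at UNIFORMLY TAME REALISING data IS w5-d009's integer predicate
# (sequel of `Cor312SlotLicenceTame.lean`): the whole mover chain
# of abc-iut-w5-d236 / abc-iut-w4-d006 (multi-slot movers ⇒ targets ⇒ tame slots ⇒ tame ORDERS) lives in (Ind2), hence proves
# `Cor312.Setting.SlotLicence`; with abc-iut-w5-d009's tame iff this DECIDES the γ line's S-side clause at uniformly tame realising data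

PROOF-ONLY record file (D-0012; 0 definitions, 0 `Prop` facts) of the abc-iut cell (branch C certificate seat abc-iut-C-cert-2 gen 3; sequel of
`Cor312SlotLicenceMovers.lean`, p460145 — the γ line's non-vacuity). TAKES NO SIDE on [IUTchIII] Cor. 3.12 or on any author.

Every theorem below is the VERBATIM twin of a landed (U)-licence theorem with `thetaHull ↦ thetaSlotHull` / `Licence ↦ SlotLicence` — the
proofs are unchanged except that the moved box point is booked in `⋃₀ thetaSlotImages` (its moving family is an (Ind2)-FAMILY,
`LogShells.exists_mem_Ind2Family_apply_eq`; no capsule permutation, no strip automorphism is ever used):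
* `qRegion_subset_thetaSlotHull_settingDHVolSharp_inl` / `_of_slotMovers` / `_of_targets` / `_of_tame_slots` / `_of_forall_not_mem` ←
  abc-iut-w5-d236 `Cor312LicenceShallowMultiSlot` (p? — `…thetaHull…` twins);
* `qRegion_subset_thetaSlotHull_settingDHVolSharp_of_tame_orders`, `slotLicence_settingDHVolSharp_of_tame_orders`,
  `slotLicence_settingPrVolSharp_of_tame_orders` ← abc-iut-w4-d006 / w5-d236 `Cor312LicenceShallowMultiSlotLicence`;
* **`slotLicence_settingPrVolSharp_iff_of_realises_tame`** — at Θ- and q-ideles REALISING the pilot divisors with integral q-degrees `P_w ≥ 1` and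
  uniformly tame bad fibres (`e_p ≤ p − 2`): `SlotLicence ⟺ ∀ bad w | p, ∀ j = i+1: e_p·((j²P_w − 1) div e_p) + 1 − j(e_p − 1) ≤ P_w` — the SAME
  integer predicate as abc-iut-w5-d009's `licence_settingPrVolSharp_iff_of_realises_tame` (p448597): (⟹) through `licence_of_slotLicence` and
  w5-d009's (⟹); (⟸) through the slot-licence tame-orders chain. So at uniformly tame realising data the (U)-licence and the SLOT licence are
  EQUIVALENT and decided by ONE integer predicate: every WINDOW-TABLE U1 verdict is a verdict for the γ line's S-side clause too.

HONEST SCOPE: statements about OUR typed sharp containers and Dupuy–Hilado's typed (Ind2); the slot licence is a STRONGER-THAN-PRINT reading of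
Step (xi-f); nothing here asserts or refutes [IUTchIII] Cor. 3.12 or bears on the printed global inequality. [cite: DupuyHilado2025, §3.3, §3.4,
§3.9, §4.9, §4.11–4.12] [cite: NeukirchANT1999, Ch. II Prop. (5.5), (6.8)] [cite: WeilBNT1967, Ch. II §2, Th. 1] [claim: Mochizuki2012, status: disputed]
for every IUT sentence quoted. typed ≠ proved; instantiated ≠ endorsed.
-/

noncomputable section

open Set Function
open scoped Pointwise

namespace Summit.ABC.IUTFork.Thm311.Real

open Cor312 Cor312.Setting Cor312Vol Cor312Vol.ExplicitDepth Literature.IUT.LogThetaLattice Literature.IUT.LogVolume NumberField IsDedekindDomain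
open Literature.NumberTheory.NumberFields Literature.NumberTheory.GaloisRepresentations.Ultrametric

variable {F : Type} [Field F] [NumberField F] (X : PilotData F) {logv : PadicLogs F} (hlog : LogvAnalytic logv)
  (M : Type) [Field M] [NumberField M]
  (archPk : ∀ (j : (thetaIndex X).Label) (vQ : (thetaIndex X).VQ), Set ((logShellsDH X logv).Packet j vQ))
  (archSub : ∀ (j : (thetaIndex X).Label) (v : (thetaIndex X).V),
    Set ((logShellsDH X logv).Packet j ((thetaIndex X).over v)))
  (Ψ : ℤ → ∀ v : (thetaIndex X).V, v ∈ (thetaIndex X).Vbad → Set ((logShellsDH X logv).StarPacket v))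
  (act : ℤ → ∀ v : (thetaIndex X).V, v ∈ (thetaIndex X).Vbad →
    (logShellsDH X logv).StarPacket v → Module.End ℚ ((logShellsDH X logv).StarPacket v))
  (Mmod : ℤ → ∀ j : (thetaIndex X).LabelStar, Set ((logShellsDH X logv).GlobalPacket j.1))
  (region : ℤ → ∀ j : (thetaIndex X).LabelStar, FinDivisor M → ∀ vQ : (thetaIndex X).VQ,
    Set ((logShellsDH X logv).Packet j.1 vQ))
  (n : ℤ) {HT : Type} {LogLink : HT → HT → Type} {IsFull : ∀ {s t : HT}, LogLink s t → Prop}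
  (lat : LGPGaussianLogThetaLattice LogLink IsFull)
  {Frd : Type} {IsoF : Frd → Frd → Type} {Ob : Frd → Type} {realify : Frd → Frd} {Strip : Type}
  {IsoS : Strip → Strip → Type} {Mv : ∀ v : (thetaIndex X).V, v ∈ (thetaIndex X).Vbad → Type}
  [∀ v h, Monoid (Mv v h)]
  (sig : GlobalLGPFrobenioidSignature (thetaIndex X).lstar (thetaIndex X).V (· ∈ (thetaIndex X).Vbad)
    Frd IsoF Ob realify Strip IsoS Mv)
  (split : SplittingMonoids Mv) {ObΔ : Type} {N : ∀ v : (thetaIndex X).V, v ∈ (thetaIndex X).Vbad → Type}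
  [∀ v h, Monoid (N v h)] (qData : QPilotData ObΔ N)
  (tq : ∀ (pp : Nat.Primes) (x : (thetaIndex X).Fibre (.inr pp)), haveI : Fact (pp : ℕ).Prime := ⟨pp.2⟩; kOf X pp.1 x)
  (t : ∀ (pp : Nat.Primes) (_ : Fin X.lstar) (x : (thetaIndex X).Fibre (.inr pp)),
    haveI : Fact (pp : ℕ).Prime := ⟨pp.2⟩; kOf X pp.1 x)
  (htq0 : ∀ pp x, tq pp x ≠ 0)
  (htq1 : ∀ (pp : Nat.Primes) (x : (thetaIndex X).Fibre (.inr pp)),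
    haveI : Fact (pp : ℕ).Prime := ⟨pp.2⟩; placeOf X pp.1 x ∉ X.S → ‖tq pp x‖ = 1)
  (col : ℤ → Column (logShellsDH X logv))


/-- **THE SLOT LICENCE AT `settingPrVolSharp` FOR REALISING IDELES WITH INTEGRAL q-DEGREES AND UNIFORMLY TAME BAD FIBRES IS w5-d009's EXACT
TAME PREDICATE** — hence EQUIVALENT to the (U)-licence there. (⟹) `licence_of_slotLicence` + abc-iut-w5-d009
`licence_settingPrVolSharp_iff_of_realises_tame`; (⟸) the slot tame-orders chain with `m_Θ = j²·P_w`, `m_q = P_w` read off the realising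
ideles (w5-d009's bookkeeping `norm_thetaIdele_eq_rpow_of_realises` / `norm_qIdele_eq_rpow_of_realises`, uniformizers of the rescaled completions).
[cite: DupuyHilado2025, §3.3, §3.4, §4.9] [cite: NeukirchANT1999, Ch. II Prop. (5.5), (6.8)] [claim: Mochizuki2012, status: disputed] -/
theorem slotLicence_settingPrVolSharp_iff_of_realises_tame
    (ht0 : ∀ pp i x, t pp i x ≠ 0)
    (ht : ∀ (pp : Nat.Primes) (i : Fin X.lstar) (x : (thetaIndex X).Fibre (.inr pp)),
      haveI : Fact (pp : ℕ).Prime := ⟨pp.2⟩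
      Real.log ‖t pp i x‖ = -(X.thetaPilot i (placeOf X pp.1 x)) * logNorm F (placeOf X pp.1 x) /
        localDegree F (placeOf X pp.1 x))
    (htq : ∀ (pp : Nat.Primes) (x : (thetaIndex X).Fibre (.inr pp)),
      haveI : Fact (pp : ℕ).Prime := ⟨pp.2⟩
      Real.log ‖tq pp x‖ = -(X.qPilot (placeOf X pp.1 x)) * logNorm F (placeOf X pp.1 x) /
        localDegree F (placeOf X pp.1 x))
    (e : Nat.Primes → ℕ)
    (hfib : ∀ (pp : Nat.Primes) (x : (thetaIndex X).Fibre (.inr pp)),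
      haveI : Fact (pp : ℕ).Prime := ⟨pp.2⟩
      (∃ w : (thetaIndex X).Fibre (.inr pp), placeOf X pp.1 w ∈ X.S) →
        2 < (pp : ℕ) ∧ e pp ≤ (pp : ℕ) - 2 ∧ (placeOf X pp.1 x).asIdeal.ramificationIdx ℤ = e pp)
    (P : ∀ pp : Nat.Primes, (thetaIndex X).Fibre (.inr pp) → ℕ)
    (hP : ∀ (pp : Nat.Primes) (w : (thetaIndex X).Fibre (.inr pp)),
      haveI : Fact (pp : ℕ).Prime := ⟨pp.2⟩; placeOf X pp.1 w ∈ X.S → X.qPilot (placeOf X pp.1 w) = P pp w)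
    (hP1 : ∀ (pp : Nat.Primes) (w : (thetaIndex X).Fibre (.inr pp)),
      haveI : Fact (pp : ℕ).Prime := ⟨pp.2⟩; placeOf X pp.1 w ∈ X.S → 1 ≤ P pp w) :
    (settingPrVolSharp X hlog M archPk archSub Ψ act Mmod region n lat sig split qData tq t htq0 htq1).SlotLicence ↔
      ∀ (pp : Nat.Primes) (i : Fin (thetaIndex X).lstar) (w : (thetaIndex X).Fibre (.inr pp)),
        haveI : Fact (pp : ℕ).Prime := ⟨pp.2⟩; placeOf X pp.1 w ∈ X.S →
          (e pp : ℤ) * (((((i : ℕ) + 1 : ℕ) : ℤ) ^ 2 * (P pp w : ℤ) - 1) / e pp) + 1 -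
            ((i : ℕ) + 1 : ℕ) * ((e pp : ℤ) - 1) ≤ (P pp w : ℤ) := by
  constructor
  · intro h
    exact (licence_settingPrVolSharp_iff_of_realises_tame X hlog M archPk archSub Ψ act Mmod region n lat sig split qData tq t htq0 htq1
      ht0 ht htq e hfib P hP hP1).1 (Cor312.Setting.licence_of_slotLicence _ h)
  · intro hwin
    -- uniformizers of the rescaled completions, `‖ϖ_x‖ = p^{−1/e(x|p)}` (abc-iut-w5-d009's bookkeeping, verbatim)
    have hex : ∀ (pp : Nat.Primes) (x : (thetaIndex X).Fibre (.inr pp)),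
        haveI : Fact (pp : ℕ).Prime := ⟨pp.2⟩
        ∃ ϖ : (kOf X pp.1 x)ˣ, IsUniformizer ϖ ∧ ‖(ϖ : kOf X pp.1 x)‖ =
          ((pp : ℕ) : ℝ) ^ (-(1 / ((placeOf X pp.1 x).asIdeal.ramificationIdx ℤ : ℝ))) := fun pp x => by
      haveI : Fact (pp : ℕ).Prime := ⟨pp.2⟩
      exact exists_isUniformizer_rescaledCompletion F pp.1 (placeOf X pp.1 x) (natCast_mem_placeOf X pp.1 x)
    choose ϖ hϖ using hex
    have key : ∀ (pp : Nat.Primes) (w : (thetaIndex X).Fibre (.inr pp)),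
        haveI : Fact (pp : ℕ).Prime := ⟨pp.2⟩
        placeOf X pp.1 w ∈ X.S → ∀ m : ℤ, ∀ c : ℝ, (c : ℝ) = (m : ℝ) →
          ((pp : ℕ) : ℝ) ^ (-(c * X.qPilot (placeOf X pp.1 w)) / (ramIdx F (placeOf X pp.1 w) : ℝ)) =
            ‖(ϖ pp w : kOf X pp.1 w)‖ ^ (m * (P pp w : ℤ)) := by
      intro pp w hw m c hc
      haveI : Fact (pp : ℕ).Prime := ⟨pp.2⟩
      obtain ⟨-, -, hram⟩ := hfib pp w ⟨w, hw⟩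
      have hp0 : (0 : ℝ) < ((pp : ℕ) : ℝ) := by exact_mod_cast pp.2.pos
      have hramF : (ramIdx F (placeOf X pp.1 w) : ℝ) = (e pp : ℝ) := by
        rw [ramIdx_eq F (placeOf X pp.1 w), hram]
      have hϖn : ‖(ϖ pp w : kOf X pp.1 w)‖ = ((pp : ℕ) : ℝ) ^ (-(1 / (e pp : ℝ))) := by
        rw [(hϖ pp w).2, hram]
      rw [hϖn, ← Real.rpow_intCast, ← Real.rpow_mul hp0.le, hP pp w hw, hramF, hc]
      congr 1
      push_cast
      ring
    rw [slotLicence_settingPrVolSharp_iff_settingDHVolSharp]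
    refine slotLicence_settingDHVolSharp_of_tame_orders X hlog M archPk archSub Ψ act Mmod region n lat sig split qData tq t htq0 htq1
      (fun pp i x hx => norm_eq_one_of_realises X t ht0 ht pp i x hx) e ϖ (fun pp x hS => ?_) (fun pp i w hw => ?_)
    · haveI : Fact (pp : ℕ).Prime := ⟨pp.2⟩
      obtain ⟨hp2, hep, hram⟩ := hfib pp x hS
      exact ⟨hp2, hep, hram, (hϖ pp x).1⟩
    · haveI : Fact (pp : ℕ).Prime := ⟨pp.2⟩
      refine Or.inr ⟨(((i : ℕ) + 1 : ℕ) : ℤ) ^ 2 * (P pp w : ℤ), (P pp w : ℤ), ?_, ?_, ?_, hwin pp i w hw⟩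
      · -- `‖t_{Θ,i,w}‖ = ‖ϖ_w‖^{(i+1)²·P_w}`
        rw [norm_thetaIdele_eq_rpow_of_realises X tq t htq0 ht0 ht htq pp i w]
        exact key pp w hw _ _ (by push_cast; ring)
      · -- `‖t_{q,w}‖ = ‖ϖ_w‖^{P_w}`
        rw [norm_qIdele_eq_rpow_of_realises X tq htq0 htq pp w]
        have h := key pp w hw 1 1 (by norm_num)
        rw [one_mul, one_mul] at h
        exact h
      · -- `1 ≤ (i+1)²·P_w`
        have h1 : (1 : ℤ) ≤ (P pp w : ℤ) := by exact_mod_cast hP1 pp w hw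
        have h2 : (1 : ℤ) ≤ (((i : ℕ) + 1 : ℕ) : ℤ) ^ 2 := one_le_pow₀ (by exact_mod_cast Nat.succ_le_succ (Nat.zero_le _))
        nlinarith

end Summit.ABC.IUTFork.Thm311.Real

end
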